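import Literature.Analysis.FluidPDE.GIPStabilityOfDecay
import Literature.Analysis.FluidPDE.GIPDecay
import HarnessLib

/-!
# Discharge of `GIP2003_L3_stability` (Gallagher–Iftimie–Planchon 2003, Thm. 0.1)

Analysis/FluidPDE proof file (theorems only): the named fact
`Literature.Analysis.FluidPDE.GIP2003_L3_stability` (`GIPGlobalStability.lean`; I. Gallagher,
D. Iftimie, F. Planchon, *Asymptotics and stability for global solutions to the Navier–Stokes
equations*, Ann. Inst. Fourier 53 (2003) 1387–1424, Thm. 0.1 p. 1389) holds:

* bullet (i), decay `‖u(t)‖₃ → 0` of an a priori global `C_t(L³)` (Kato) solution, is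
  `GIP2003.tendsto_eLpNorm_three_of_global` (`GIPDecay.lean`; GIP Thm. 2.1, pp. 1395–1398);
* bullet (ii), stability (openness of the set of data with a global solution and the Lipschitz
  bound `‖v(t) - u(t)‖₃ ≤ C(u)‖v₀ - u₀‖₃`), is `GIP2003.stability_of_decay`
  (`GIPStabilityOfDecay.lean`; GIP Thm. 3.1–3.2, pp. 1398–1402), which takes (i) as input.

The hypotheses of the fact (a witness of `HasGlobalKatoSolution 1 u₀`) are repackaged as a Kato
solution on every `[0, T)` (`GIP2003.isKatoSolutionOn_of_global`). The proof lives in this sibling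
file because the proof files import `GIPGlobalStability.lean`.

## References

* I. Gallagher, D. Iftimie, F. Planchon, Ann. Inst. Fourier 53 (2003) 1387–1424,
  doi:10.5802/aif.1983: Thm. 0.1 (p. 1389); Thm. 2.1 (pp. 1395–1398); Thm. 3.1–3.2
  (pp. 1398–1402). [GallagherIftimiePlanchon2003]
-/

noncomputable section

open MeasureTheory Set Function Filter
open _root_.Topology
open scoped ENNReal

namespace Literature.Analysis.FluidPDE

/-- **Discharge of `GIP2003_L3_stability`** (Gallagher–Iftimie–Planchon 2003, Thm. 0.1,
"Stability in `L³`", both bullets): decay by `GIP2003.tendsto_eLpNorm_three_of_global`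
(Thm. 2.1), stability by `GIP2003.stability_of_decay` (Thm. 3.1–3.2).
[cite: GallagherIftimiePlanchon2003, Thm. 0.1 (p. 1389); Thm. 2.1; Thm. 3.1–3.2 (10)] -/
theorem GIP2003_L3_stability_holds : GIP2003_L3_stability := by
  intro u₀ u _hu₀ _hdiv hmild hcont h0 hmeas
  have hK : ∀ T : ℝ, 0 < T → IsKatoSolutionOn T 1 u₀ u := fun T _ =>
    GIP2003.isKatoSolutionOn_of_global hmild hcont h0 hmeas T
  have hdecay : Tendsto (fun t => eLpNorm (u t) 3 volume) atTop (𝓝 0) :=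
    GIP2003.tendsto_eLpNorm_three_of_global hK
  exact ⟨hdecay, GIP2003.stability_of_decay hK hdecay⟩

end Literature.Analysis.FluidPDE

end
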